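/-
Copyright (c) 2026. All rights reserved.
Released under Apache 2.0 license as described in the file LICENSE.
-/
import Literature.NumberTheory.Automorphic.EichlerOrdersTypeFibres
import Mathlib.GroupTheory.NoncommPiCoprod
import Mathlib.GroupTheory.GroupAction.Quotient
import HarnessLib

/-!
# The Atkin–Lehner group `(ℤ/2ℤ)^{ω(N⁺N⁻)}` of an Eichler order acting on its class set: orbits = fibres of the type map,
# Burnside's count, and `#Cls O ≤ 2^{ω(N⁺N⁻)} · #Typ O` (Voight (23.4.20), Prop. 18.5.10, Cor. 18.5.12)

[tag: quaternion_algebra] [tag: class_number] [tag: eichler_order]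

Topic `NumberTheory/Automorphic`; THEOREMS ONLY (no definition, no named fact, no instance; net Literature debt `0`).
Lane `lit-hodgefound`, seat p12, gen 51 — sequel of `EichlerOrdersTypeFibres.lean` (the fibres of `Cls O → Typ O` are the
classes reachable by the involutions `W_{q⁻}`, `W_{p⁺}`) and the Eichler-level analogue of
`DefiniteMaximalOrdersTypeNumberTrace.lean` (maximal orders, where the fixed points are traces of Brandt matrices).

For EVERY Brandt setup `S` of type `(N⁺, N⁻)`, with `P` the set of primes of `N⁺N⁻` and the commuting involutions
`W_r = W_{r⁻}` (`r ∣ N⁻`), `W_r = W_{r⁺}` (`r ∣ N⁺`) of `Cls O`: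

* **`XiSetup.exists_atkinLehner_action`** — there is a homomorphism `Φ : (ℤ/2ℤ)^P → Sym(Cls O)` with `Φ(e_r) = W_r`, whose
  orbits are the fibres of the type map (`typeOf c' = typeOf c ↔ ∃ g, Φ(g) c = c'`), and **Burnside's count
  `∑_{g ∈ (ℤ/2ℤ)^P} #Fix(Φ g) = 2^{#P} · #Typ O`** (Voight Cor. 18.5.12: `#Cls O = ∑_{[O']} [Idl(O') : PIdl(O')]`, the fibres
  are `Idl(O')/ℚ^× ≃ (ℤ/2ℤ)^P`-torsors modulo stabilisers);
* **`XiSetup.natCard_classSet_le_two_pow_card_primeFactors_mul_natCard_typeSet`**: `#Cls O ≤ 2^{ω(N⁺N⁻)} · #Typ O`;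
* **`XiSetup.natCard_typeSet_eq_natCard_classSet_iff_forall_atkinLehner`**: `#Typ O = #Cls O` iff all the involutions
  `W_{q⁻}`, `W_{p⁺}` are trivial on `Cls O`.

## References

* [Voight2021] J. Voight, *Quaternion Algebras*, GTM 288 (2021): (23.4.20), Prop. 18.5.10, Cor. 18.5.12, Thm. 18.1.3.
* [VignerasLNM800] M.-F. Vignéras, *Arithmétique des algèbres de quaternions*, LNM 800 (1980), Ch. III §5 exercice 5.8, Ch. V §2
  (the paragraph after Cor. 2.5: `2^r = [N(O_A) : O_A^× K_A^×]`).

## Scope (honest)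

Theorems only. The group is presented through an existentially quantified homomorphism `Φ` (no new definition); the
identification of `#Fix(Φ(1_s))` with traces of (modified) Brandt matrices at the level primes is not made here.
-/

noncomputable section

open scoped Pointwise

universe u

namespace Literature.NumberTheory.Automorphic

namespace Brandt

/-! ## §1 Commuting involutions: the action of `(ℤ/2ℤ)^ι` (as in `DefiniteMaximalOrdersTypeNumberTrace`) -/

/-- Pairwise commuting involutions `W_i` of `X` (`i ∈ ι`, finite) extend to a homomorphism `(ι → ℤ/2ℤ) → Sym X` sending the
`i`-th basis vector to `W_i`. [folklore] -/
private theorem exists_monoidHom_of_commuting_involutions {X ι : Type*} [Fintype ι] [DecidableEq ι]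
    (W : ι → Equiv.Perm X) (hW2 : ∀ i, W i ^ 2 = 1) (hc : ∀ i j, Commute (W i) (W j)) :
    ∃ Φ : (ι → Multiplicative (ZMod 2)) →* Equiv.Perm X,
      ∀ i, Φ (Pi.mulSingle i (Multiplicative.ofAdd 1)) = W i := by
  have hpow : ∀ i (k : ℕ), W i ^ (k % 2) = W i ^ k := fun i k => by
    conv_rhs => rw [← Nat.mod_add_div k 2, pow_add, pow_mul, hW2 i, one_pow, mul_one]
  let ϕ : ∀ _ : ι, Multiplicative (ZMod 2) →* Equiv.Perm X := fun i =>
    { toFun := fun z => W i ^ (Multiplicative.toAdd z).val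
      map_one' := by simp
      map_mul' := fun a b => by simp only [toAdd_mul, ZMod.val_add, hpow, pow_add] }
  have hϕ : ∀ i z, ϕ i z = W i ^ (Multiplicative.toAdd z).val := fun _ _ => rfl
  have hcomm : Pairwise fun i j => ∀ a b, Commute (ϕ i a) (ϕ j b) := fun i j _ a b => by
    rw [hϕ, hϕ]; exact (hc i j).pow_pow _ _
  refine ⟨MonoidHom.noncommPiCoprod ϕ hcomm, fun i => ?_⟩
  rw [MonoidHom.noncommPiCoprod_mulSingle, hϕ, toAdd_ofAdd, ZMod.val_one, pow_one]

/-- The two elements of `ℤ/2ℤ` (multiplicative notation). [folklore] -/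
private theorem eq_one_or_eq_ofAdd_one (z : Multiplicative (ZMod 2)) : z = 1 ∨ z = Multiplicative.ofAdd 1 := by
  revert z; decide

/-- Every `Φ(g) x` is reachable from `x` by the involutions `W_i`. [folklore] -/
private theorem reflTransGen_hom_apply {X ι : Type*} [Fintype ι] [DecidableEq ι] (W : ι → Equiv.Perm X)
    (Φ : (ι → Multiplicative (ZMod 2)) →* Equiv.Perm X) (hΦ : ∀ i, Φ (Pi.mulSingle i (Multiplicative.ofAdd 1)) = W i)
    (g : ι → Multiplicative (ZMod 2)) (x : X) :
    Relation.ReflTransGen (fun a b => ∃ i, W i a = b) x (Φ g x) := by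
  suffices key : ∀ s : Finset ι,
      Relation.ReflTransGen (fun a b => ∃ i, W i a = b) x (Φ (∏ i ∈ s, Pi.mulSingle i (g i)) x) by
    have := key Finset.univ
    rwa [Finset.univ_prod_mulSingle] at this
  intro s
  induction s using Finset.induction_on with
  | empty =>
    rw [show Φ (∏ i ∈ (∅ : Finset ι), Pi.mulSingle i (g i)) x = x by
      rw [Finset.prod_empty, map_one, Equiv.Perm.coe_one, id_eq]]
  | @insert j s hj ih =>
    rw [Finset.prod_insert hj, map_mul, Equiv.Perm.coe_mul, Function.comp_apply]
    rcases eq_one_or_eq_ofAdd_one (g j) with h | h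
    · rw [h, Pi.mulSingle_one, map_one, Equiv.Perm.coe_one, id_eq]; exact ih
    · rw [h, hΦ]
      exact ih.tail ⟨j, rfl⟩

/-- Conversely, a class reachable from `x` by the `W_i` is some `Φ(g) x`. [folklore] -/
private theorem exists_hom_apply_eq_of_reflTransGen {X ι : Type*} [Fintype ι] [DecidableEq ι] (W : ι → Equiv.Perm X)
    (Φ : (ι → Multiplicative (ZMod 2)) →* Equiv.Perm X) (hΦ : ∀ i, Φ (Pi.mulSingle i (Multiplicative.ofAdd 1)) = W i)
    {x y : X} (h : Relation.ReflTransGen (fun a b => ∃ i, W i a = b) x y) :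
    ∃ g : ι → Multiplicative (ZMod 2), Φ g x = y := by
  induction h with
  | refl => exact ⟨1, by rw [map_one, Equiv.Perm.coe_one, id_eq]⟩
  | tail _ hbc ih =>
    obtain ⟨g, rfl⟩ := ih
    obtain ⟨i, rfl⟩ := hbc
    exact ⟨Pi.mulSingle i (Multiplicative.ofAdd 1) * g, by rw [map_mul, Equiv.Perm.coe_mul, Function.comp_apply, hΦ]⟩


/-! ## §2 The Atkin–Lehner group of an Eichler order acting on `Cls O` -/

variable {Nplus Nminus : ℕ} (S : XiSetup Nplus Nminus)

/-- **THE ATKIN–LEHNER GROUP `(ℤ/2ℤ)^{ω(N⁺N⁻)}` ACTS ON `Cls O` WITH ORBIT SPACE `Typ O`** (every Brandt setup of type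
`(N⁺, N⁻)`): there is a homomorphism `Φ : (P → ℤ/2ℤ) → Sym(Cls O)`, `P` the primes of `N⁺N⁻`, sending the basis vector at
`q ∣ N⁻` to `W_{q⁻}` and at `p ∣ N⁺` to `W_{p⁺}`, such that `typeOf c' = typeOf c ↔ ∃ g, Φ(g) c = c'`
(`EichlerOrdersTypeFibres`), and **Burnside's count `∑_g #Fix(Φ g) = 2^{#P} · #Typ O`** (Voight Cor. 18.5.12 with (23.4.20):
the fibres of the type map are torsors under `Idl(O')/ℚ^× ≃ (ℤ/2ℤ)^P` modulo stabilisers).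
[cite: Voight2021, Prop. 18.5.10, Cor. 18.5.12 and (23.4.20)] [cite: VignerasLNM800, Ch. V §2 (after Cor. 2.5)] -/
theorem XiSetup.exists_atkinLehner_action [Fintype (ClassSet S.O)] :
    ∃ Φ : (↥(Nplus * Nminus).primeFactors → Multiplicative (ZMod 2)) →* Equiv.Perm (ClassSet S.O),
      (∀ (q : ℕ) (_ : Fact q.Prime) (hq : q ∣ Nminus) (hm : q ∈ (Nplus * Nminus).primeFactors) (c : ClassSet S.O),
          Φ (Pi.mulSingle ⟨q, hm⟩ (Multiplicative.ofAdd 1)) c = S.wMinus q hq c) ∧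
      (∀ (p : ℕ) (_ : Fact p.Prime) (hp : ¬ p ∣ Nminus) (hm : p ∈ (Nplus * Nminus).primeFactors) (c : ClassSet S.O),
          Φ (Pi.mulSingle ⟨p, hm⟩ (Multiplicative.ofAdd 1)) c = S.wPlus p hp c) ∧
      (∀ c c' : ClassSet S.O, typeOf S.O c' = typeOf S.O c ↔ ∃ g, Φ g c = c') ∧
      ∑ g : ↥(Nplus * Nminus).primeFactors → Multiplicative (ZMod 2), Nat.card {c : ClassSet S.O // Φ g c = c} =
        2 ^ (Nplus * Nminus).primeFactors.card * Nat.card (TypeSet S.O) := by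
  classical
  have hN0 : Nplus * Nminus ≠ 0 := mul_ne_zero S.nplus_ne_zero S.squarefree.ne_zero
  have hprime : ∀ i : ↥(Nplus * Nminus).primeFactors, (i : ℕ).Prime := fun i => Nat.prime_of_mem_primeFactors i.2
  -- the involutions `W_r`
  set F : ↥(Nplus * Nminus).primeFactors → ClassSet S.O → ClassSet S.O := fun i c =>
    if h : (i : ℕ) ∣ Nminus then @XiSetup.wMinus Nplus Nminus S i ⟨hprime i⟩ h c
    else @XiSetup.wPlus Nplus Nminus S i ⟨hprime i⟩ h c with hFdef
  have hF_dvd : ∀ (i : ↥(Nplus * Nminus).primeFactors) (h : (i : ℕ) ∣ Nminus) (c : ClassSet S.O),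
      F i c = @XiSetup.wMinus Nplus Nminus S i ⟨hprime i⟩ h c := fun i h c => by
    simp only [hFdef, dif_pos h]
  have hF_ndvd : ∀ (i : ↥(Nplus * Nminus).primeFactors) (h : ¬ (i : ℕ) ∣ Nminus) (c : ClassSet S.O),
      F i c = @XiSetup.wPlus Nplus Nminus S i ⟨hprime i⟩ h c := fun i h c => by
    simp only [hFdef, dif_neg h]
  have hFinv : ∀ i, Function.Involutive (F i) := fun i c => by
    by_cases h : (i : ℕ) ∣ Nminus
    · rw [hF_dvd i h, hF_dvd i h]
      exact @XiSetup.wMinus_wMinus Nplus Nminus S i ⟨hprime i⟩ h c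
    · rw [hF_ndvd i h, hF_ndvd i h]
      exact @XiSetup.wPlus_wPlus Nplus Nminus S i ⟨hprime i⟩ h c
  set W : ↥(Nplus * Nminus).primeFactors → Equiv.Perm (ClassSet S.O) := fun i => (hFinv i).toPerm _ with hWdef
  have hWF : ∀ i c, W i c = F i c := fun _ _ => rfl
  have hW2 : ∀ i, W i ^ 2 = 1 := fun i => by
    ext c
    rw [sq, Equiv.Perm.coe_mul, Function.comp_apply, hWF, hWF, Equiv.Perm.coe_one, id_eq]
    exact hFinv i c
  have hc : ∀ i j, Commute (W i) (W j) := fun i j => by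
    ext c
    rw [Equiv.Perm.coe_mul, Function.comp_apply, Equiv.Perm.coe_mul, Function.comp_apply, hWF, hWF, hWF, hWF]
    by_cases hi : (i : ℕ) ∣ Nminus <;> by_cases hj : (j : ℕ) ∣ Nminus
    · rw [hF_dvd i hi, hF_dvd j hj, hF_dvd i hi, hF_dvd j hj]
      exact @XiSetup.wMinus_comm Nplus Nminus S i j ⟨hprime i⟩ ⟨hprime j⟩ hi hj c
    · rw [hF_dvd i hi, hF_ndvd j hj, hF_dvd i hi, hF_ndvd j hj]
      exact (@XiSetup.wPlus_wMinus_comm Nplus Nminus S j i ⟨hprime j⟩ ⟨hprime i⟩ hj hi c).symm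
    · rw [hF_ndvd i hi, hF_dvd j hj, hF_ndvd i hi, hF_dvd j hj]
      exact @XiSetup.wPlus_wMinus_comm Nplus Nminus S i j ⟨hprime i⟩ ⟨hprime j⟩ hi hj c
    · rw [hF_ndvd i hi, hF_ndvd j hj, hF_ndvd i hi, hF_ndvd j hj]
      exact @XiSetup.wPlus_comm Nplus Nminus S i j ⟨hprime i⟩ ⟨hprime j⟩ hi hj c
  obtain ⟨Φ, hΦ⟩ := exists_monoidHom_of_commuting_involutions W hW2 hc
  -- the orbits are the fibres of the type map
  have horb : ∀ c c' : ClassSet S.O, typeOf S.O c' = typeOf S.O c ↔ ∃ g, Φ g c = c' := by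
    intro c c'
    rw [S.typeOf_eq_typeOf_iff_reflTransGen_atkinLehner]
    constructor
    · intro h
      -- every Atkin–Lehner step is a `W_i` step or the identity
      have h' : Relation.ReflTransGen (fun x y => ∃ i, W i x = y) c c' := by
        induction h with
        | refl => exact Relation.ReflTransGen.refl
        | tail _ hbc ih =>
          rcases hbc with ⟨q, hf, hq, rfl⟩ | ⟨p, hf, hp, rfl⟩
          · have hm : q ∈ (Nplus * Nminus).primeFactors :=
              Nat.mem_primeFactors.mpr ⟨hf.out, hq.mul_left Nplus, hN0⟩
            exact ih.tail ⟨⟨q, hm⟩, by rw [hWF, hF_dvd ⟨q, hm⟩ hq]⟩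
          · by_cases hpN : p ∣ Nplus
            · have hm : p ∈ (Nplus * Nminus).primeFactors :=
                Nat.mem_primeFactors.mpr ⟨hf.out, hpN.mul_right Nminus, hN0⟩
              exact ih.tail ⟨⟨p, hm⟩, by rw [hWF, hF_ndvd ⟨p, hm⟩ hp]⟩
            · rw [S.wPlus_eq_self_of_not_dvd hp hpN]
              exact ih
      exact exists_hom_apply_eq_of_reflTransGen W Φ hΦ h'
    · rintro ⟨g, rfl⟩
      refine Relation.ReflTransGen.mono (fun x y => ?_) _ _ (reflTransGen_hom_apply W Φ hΦ g c)
      rintro ⟨i, rfl⟩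
      by_cases hi : (i : ℕ) ∣ Nminus
      · exact Or.inl ⟨i, ⟨hprime i⟩, hi, by rw [hWF, hF_dvd i hi]⟩
      · exact Or.inr ⟨i, ⟨hprime i⟩, hi, by rw [hWF, hF_ndvd i hi]⟩
  refine ⟨Φ, fun q _ hq hm c => ?_, fun p _ hp hm c => ?_, horb, ?_⟩
  · rw [hΦ ⟨q, hm⟩, hWF, hF_dvd ⟨q, hm⟩ hq]
  · rw [hΦ ⟨p, hm⟩, hWF, hF_ndvd ⟨p, hm⟩ hp]
  -- Burnside
  letI : MulAction (↥(Nplus * Nminus).primeFactors → Multiplicative (ZMod 2)) (ClassSet S.O) := MulAction.compHom _ Φ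
  have hsmul : ∀ (g : ↥(Nplus * Nminus).primeFactors → Multiplicative (ZMod 2)) (c : ClassSet S.O), g • c = Φ g c :=
    fun _ _ => rfl
  have burnside := MulAction.sum_card_fixedBy_eq_card_orbits_mul_card_group
    (↥(Nplus * Nminus).primeFactors → Multiplicative (ZMod 2)) (ClassSet S.O)
  have hG : Fintype.card (↥(Nplus * Nminus).primeFactors → Multiplicative (ZMod 2)) =
      2 ^ (Nplus * Nminus).primeFactors.card := by
    rw [Fintype.card_fun, Fintype.card_multiplicative, ZMod.card, Fintype.card_coe]
  have hrel : ∀ a b : ClassSet S.O,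
      (MulAction.orbitRel (↥(Nplus * Nminus).primeFactors → Multiplicative (ZMod 2)) (ClassSet S.O)) a b ↔
        typeOf S.O a = typeOf S.O b := by
    intro a b
    rw [MulAction.orbitRel_apply, MulAction.mem_orbit_iff, horb b a]
    simp only [hsmul]
  have hΩ : Fintype.card (Quotient (MulAction.orbitRel (↥(Nplus * Nminus).primeFactors → Multiplicative (ZMod 2))
      (ClassSet S.O))) = Nat.card (TypeSet S.O) := by
    haveI : Finite (TypeSet S.O) := S.finite_typeSet
    haveI : Fintype (TypeSet S.O) := Fintype.ofFinite _
    rw [Nat.card_eq_fintype_card]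
    exact Fintype.card_congr (Quotient.congrRight fun a b => (hrel a b).trans typeOf_eq_typeOf_iff)
  have hfix : ∀ g : ↥(Nplus * Nminus).primeFactors → Multiplicative (ZMod 2),
      Fintype.card (MulAction.fixedBy (ClassSet S.O) g) = Nat.card {c : ClassSet S.O // Φ g c = c} := fun g => by
    rw [Nat.card_eq_fintype_card]
    exact Fintype.card_congr (Equiv.subtypeEquivRight fun c => by rw [MulAction.mem_fixedBy, hsmul])
  calc ∑ g : ↥(Nplus * Nminus).primeFactors → Multiplicative (ZMod 2), Nat.card {c : ClassSet S.O // Φ g c = c}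
      = ∑ g : ↥(Nplus * Nminus).primeFactors → Multiplicative (ZMod 2), Fintype.card (MulAction.fixedBy (ClassSet S.O) g) :=
        Finset.sum_congr rfl fun g _ => (hfix g).symm
    _ = 2 ^ (Nplus * Nminus).primeFactors.card * Nat.card (TypeSet S.O) := by rw [burnside, hΩ, hG, mul_comm]

/-- **`#Cls O ≤ 2^{ω(N⁺N⁻)} · #Typ O` for every Eichler order of a definite quaternion algebra over `ℚ`**: every fibre of
the type map is an orbit of the Atkin–Lehner group `(ℤ/2ℤ)^{ω(N⁺N⁻)}` (Voight Cor. 18.5.12: `#Cls O = ∑_{[O']}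
[Idl(O') : PIdl(O')] ≤ #(Idl(O)/Idl(ℤ)) · #Typ O`; (23.4.20)). [cite: Voight2021, Cor. 18.5.12 and (23.4.20)] -/
theorem XiSetup.natCard_classSet_le_two_pow_card_primeFactors_mul_natCard_typeSet :
    Nat.card (ClassSet S.O) ≤ 2 ^ (Nplus * Nminus).primeFactors.card * Nat.card (TypeSet S.O) := by
  classical
  haveI : Fintype (ClassSet S.O) := Fintype.ofFinite _
  obtain ⟨Φ, -, -, -, hsum⟩ := S.exists_atkinLehner_action
  rw [← hsum]
  have h1 : Nat.card {c : ClassSet S.O // Φ 1 c = c} = Nat.card (ClassSet S.O) :=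
    Nat.card_congr (Equiv.subtypeUnivEquiv fun c => by rw [map_one, Equiv.Perm.coe_one, id_eq])
  rw [← h1]
  exact Finset.single_le_sum (f := fun g => Nat.card {c : ClassSet S.O // Φ g c = c}) (fun _ _ => Nat.zero_le _)
    (Finset.mem_univ _)

/-- **`#Typ O = #Cls O` iff all the Atkin–Lehner involutions `W_{q⁻}` (`q ∣ N⁻`) and `W_{p⁺}` (`p ∤ N⁻`) act trivially on
`Cls O`** (every Brandt setup): the type map is injective iff its fibres — the orbits of the involutions — are singletons.
[cite: Voight2021, Cor. 18.5.12 and (23.4.20)] -/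
theorem XiSetup.natCard_typeSet_eq_natCard_classSet_iff_forall_atkinLehner :
    Nat.card (TypeSet S.O) = Nat.card (ClassSet S.O) ↔
      (∀ (q : ℕ) (_ : Fact q.Prime) (hq : q ∣ Nminus) (c : ClassSet S.O), S.wMinus q hq c = c) ∧
        (∀ (p : ℕ) (_ : Fact p.Prime) (hp : ¬ p ∣ Nminus) (c : ClassSet S.O), S.wPlus p hp c = c) := by
  classical
  haveI : Fintype (ClassSet S.O) := Fintype.ofFinite _
  haveI : Finite (TypeSet S.O) := S.finite_typeSet
  haveI : Fintype (TypeSet S.O) := Fintype.ofFinite _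
  constructor
  · intro h
    have hbij : Function.Bijective (typeOf S.O) := by
      rw [Fintype.bijective_iff_surjective_and_card]
      refine ⟨typeOf_surjective, ?_⟩
      rw [← Nat.card_eq_fintype_card, ← Nat.card_eq_fintype_card, h]
    exact ⟨fun q _ hq c => hbij.1 (S.typeOf_wMinus hq c), fun p _ hp c => hbij.1 (S.typeOf_wPlus hp c)⟩
  · rintro ⟨hM, hP⟩
    have hinj : Function.Injective (typeOf S.O) := by
      intro c c' hcc'
      have hreach := S.typeOf_eq_typeOf_iff_reflTransGen_atkinLehner.mp hcc'
      have key : ∀ a b : ClassSet S.O, Relation.ReflTransGen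
          (fun a b : ClassSet S.O =>
            (∃ (q : ℕ) (_ : Fact q.Prime) (hq : q ∣ Nminus), S.wMinus q hq a = b) ∨
              (∃ (p : ℕ) (_ : Fact p.Prime) (hp : ¬ p ∣ Nminus), S.wPlus p hp a = b)) a b → b = a := by
        intro a b hab
        induction hab with
        | refl => rfl
        | tail _ hbc ih =>
          rcases hbc with ⟨q, hf, hq, rfl⟩ | ⟨p, hf, hp, rfl⟩
          · rw [hM q hf hq, ih]
          · rw [hP p hf hp, ih]
      exact key c' c hreach
    exact (Nat.card_eq_of_bijective (typeOf S.O) ⟨hinj, typeOf_surjective⟩).symm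

end Brandt

end Literature.NumberTheory.Automorphic
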